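import Summits.QuantumAdvantage.QuantumAdvantage.Theses.CubicForrelation
import Literature.Computability.QuantumComplexity.IQPForrelation
import Literature.Computability.QuantumComplexity.ForrelationDirectSum

/-!
# `NearExactIsExact` (stmt-QuantumAdvantage-14043), line `direct-sum-amplification` — the almost-MM Walsh sum (AW)

Stub `stub_ammWalsh` of the line `direct-sum-amplification` for the crux
`Summit.QuantumAdvantage.QuantumAdvantage.Theses.CubicForrelation.NearExactIsExact`.

**What.** Let `g : 𝔽₂^{a+(a+2)} → 𝔽₂` be in the ALMOST-Maiorana–McFarland SIGN FORM with respect to an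
ARBITRARY map `φ : 𝔽₂^{a+2} → 𝔽₂^a` and an arbitrary `h : 𝔽₂^{a+2} → 𝔽₂`, i.e.
`(-1)^{g(y₁ ‖ y₂)} = (-1)^{y₁·φ(y₂)} (-1)^{h(y₂)}` for `y₁ ∈ 𝔽₂^a`, `y₂ ∈ 𝔽₂^{a+2}` (no degree hypotheses).
Then for every `f : 𝔽₂^{a+(a+2)} → 𝔽₂`

  `Φ(f, g) = 2^{-(2a+3)} ∑_{y₂} (-1)^{h(y₂)} ∑_{x₂} (-1)^{f(φ(y₂) ‖ x₂)} (-1)^{x₂·y₂}`      (`stub_ammWalsh`).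

**Proof.** The `(a, a+2)`-block twin of the landed `stub_mmWalsh`
(`Theorems/CubicForrelationNearExactIsExactMmWalsh.lean`); the same moves. Summing over the linear block
`y₁` first, character orthogonality `∑_{y₁} (-1)^{x₁·y₁} (-1)^{y₁·φ(y₂)} = 2^a [φ(y₂) = x₁]`
(`BuzetChailloux.sum_twist_left`, `twist_bxor_right`, `bxor_eq_zeroVec_iff`) gives the dual sum
`∑_y (-1)^{(x₁‖x₂)·y} (-1)^{g(y)} = 2^a ∑_{y₂ : φ(y₂) = x₁} (-1)^{x₂·y₂} (-1)^{h(y₂)}` (`aw_walsh_signForm`, via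
`sum_append`, `twist_append`); the sum over `x₁` then collapses onto `x₁ = φ(y₂)` (`aw_fsum_signForm`,
`Finset.sum_ite_eq`), and the normalisation on `n = a + (a+2)` bits is `√(2^{3(a+(a+2))}) = 2^a · 2^{2a+3}`
(`aw_sqrt_two_pow`).

References (orientation only; everything here is proved): R. L. McFarland, A family of difference sets in
non-cyclic groups, JCTA 15 (1973); R. O'Donnell, Analysis of Boolean Functions (2014), §1.4
(orthogonality of characters).
-/

set_option linter.dupNamespace false -- D-0017: single-problem summit

namespace Summit.QuantumAdvantage.QuantumAdvantage.Theorems.CubicForrelation.NearExactIsExact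

open Finset
open Literature.Computability.QuantumComplexity
open Literature.Computability.QuantumComplexity.BuzetChailloux (bxor zeroVec signOf_sq)

/-- **The dual sum of an almost-MM sign form** with an arbitrary map `φ : 𝔽₂^{a+2} → 𝔽₂^a`: for
`x = x₁ ‖ x₂` and any scalar `c`,
`∑_y c (-1)^{x·y} (-1)^{g(y)} = 2^a ∑_{y₂ : φ(y₂) = x₁} c (-1)^{x₂·y₂} (-1)^{h(y₂)}` — the sum over the linear
block `y₁ ∈ 𝔽₂^a` is `2^a [φ(y₂) = x₁]` (character orthogonality, `BuzetChailloux.sum_twist_left`). [folklore] -/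
theorem aw_walsh_signForm {a : ℕ} (g : (Fin (a + (a + 2)) → Bool) → Bool)
    (φ : (Fin (a + 2) → Bool) → (Fin a → Bool)) (h : (Fin (a + 2) → Bool) → Bool)
    (hg : ∀ (y₁ : Fin a → Bool) (y₂ : Fin (a + 2) → Bool),
      signOf (g (Fin.append y₁ y₂)) = twist y₁ (φ y₂) * signOf (h y₂))
    (c : ℝ) (x₁ : Fin a → Bool) (x₂ : Fin (a + 2) → Bool) :
    ∑ y : Fin (a + (a + 2)) → Bool, c * twist (Fin.append x₁ x₂) y * signOf (g y) =
      (2 : ℝ) ^ a * ∑ y₂ : Fin (a + 2) → Bool,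
        (if φ y₂ = x₁ then c * twist x₂ y₂ * signOf (h y₂) else 0) := by
  rw [sum_append, Finset.sum_comm, mul_sum]
  refine sum_congr rfl fun y₂ _ => ?_
  -- character orthogonality on the linear block (adapted from `mw_sum_linear_block`, MmWalsh file)
  have orth : ∑ y₁ : Fin a → Bool, twist x₁ y₁ * twist y₁ (φ y₂) =
      if φ y₂ = x₁ then (2 : ℝ) ^ a else 0 := by
    have e : ∀ y₁ : Fin a → Bool, twist x₁ y₁ * twist y₁ (φ y₂) = twist y₁ (bxor x₁ (φ y₂)) := by
      intro y₁
      rw [BuzetChailloux.twist_bxor_right, twist_comm x₁ y₁]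
    rw [sum_congr rfl fun y₁ _ => e y₁, BuzetChailloux.sum_twist_left]
    refine if_congr ?_ rfl rfl
    rw [BuzetChailloux.bxor_eq_zeroVec_iff]
    exact eq_comm
  have e : ∀ y₁ : Fin a → Bool,
      c * twist (Fin.append x₁ x₂) (Fin.append y₁ y₂) * signOf (g (Fin.append y₁ y₂)) =
        c * twist x₂ y₂ * signOf (h y₂) * (twist x₁ y₁ * twist y₁ (φ y₂)) := by
    intro y₁
    rw [twist_append, hg]
    ring
  rw [sum_congr rfl fun y₁ _ => e y₁, ← mul_sum, orth]
  split_ifs <;> ring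

/-- **The unnormalised forrelation sum of an almost-MM sign form**:
`∑_{x,y} (-1)^{f(x)} (-1)^{x·y} (-1)^{g(y)} = 2^a ∑_{y₂} (-1)^{h(y₂)} ∑_{x₂} (-1)^{f(φ(y₂) ‖ x₂)} (-1)^{x₂·y₂}`
(the dual sum `aw_walsh_signForm`, then the sum over `x₁ ∈ 𝔽₂^a` collapses onto `x₁ = φ(y₂)`).
[folklore] -/
theorem aw_fsum_signForm {a : ℕ} (f g : (Fin (a + (a + 2)) → Bool) → Bool)
    (φ : (Fin (a + 2) → Bool) → (Fin a → Bool)) (h : (Fin (a + 2) → Bool) → Bool)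
    (hg : ∀ (y₁ : Fin a → Bool) (y₂ : Fin (a + 2) → Bool),
      signOf (g (Fin.append y₁ y₂)) = twist y₁ (φ y₂) * signOf (h y₂)) :
    ∑ x : Fin (a + (a + 2)) → Bool, ∑ y : Fin (a + (a + 2)) → Bool,
        signOf (f x) * twist x y * signOf (g y) =
      (2 : ℝ) ^ a * ∑ y₂ : Fin (a + 2) → Bool, signOf (h y₂) *
        ∑ x₂ : Fin (a + 2) → Bool, signOf (f (Fin.append (φ y₂) x₂)) * twist x₂ y₂ := by
  calc ∑ x : Fin (a + (a + 2)) → Bool, ∑ y : Fin (a + (a + 2)) → Bool,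
        signOf (f x) * twist x y * signOf (g y)
      = ∑ x₁ : Fin a → Bool, ∑ x₂ : Fin (a + 2) → Bool, (2 : ℝ) ^ a * ∑ y₂ : Fin (a + 2) → Bool,
          (if φ y₂ = x₁ then signOf (f (Fin.append x₁ x₂)) * twist x₂ y₂ * signOf (h y₂) else 0) := by
        rw [sum_append]
        exact sum_congr rfl fun x₁ _ => sum_congr rfl fun x₂ _ => aw_walsh_signForm g φ h hg _ x₁ x₂
    _ = (2 : ℝ) ^ a * ∑ x₂ : Fin (a + 2) → Bool, ∑ x₁ : Fin a → Bool, ∑ y₂ : Fin (a + 2) → Bool,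
          (if φ y₂ = x₁ then signOf (f (Fin.append x₁ x₂)) * twist x₂ y₂ * signOf (h y₂) else 0) := by
        rw [mul_sum, Finset.sum_comm]
        exact sum_congr rfl fun x₂ _ => (mul_sum _ _ _).symm
    _ = (2 : ℝ) ^ a * ∑ x₂ : Fin (a + 2) → Bool, ∑ y₂ : Fin (a + 2) → Bool,
          signOf (f (Fin.append (φ y₂) x₂)) * twist x₂ y₂ * signOf (h y₂) := by
        congr 1
        refine sum_congr rfl fun x₂ _ => ?_
        rw [Finset.sum_comm]
        refine sum_congr rfl fun y₂ _ => ?_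
        rw [Finset.sum_ite_eq, if_pos (mem_univ _)]
    _ = (2 : ℝ) ^ a * ∑ y₂ : Fin (a + 2) → Bool, signOf (h y₂) *
          ∑ x₂ : Fin (a + 2) → Bool, signOf (f (Fin.append (φ y₂) x₂)) * twist x₂ y₂ := by
        rw [Finset.sum_comm]
        congr 1
        refine sum_congr rfl fun y₂ _ => ?_
        rw [mul_sum]
        refine sum_congr rfl fun x₂ _ => ?_
        ring

/-- The normalisation of `Φ` on `a + (a+2)` bits: `√(2^{3(a+(a+2))}) = 2^a · 2^{2a+3}`. [folklore] -/
theorem aw_sqrt_two_pow (a : ℕ) :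
    Real.sqrt ((2 : ℝ) ^ (3 * (a + (a + 2)))) = (2 : ℝ) ^ a * (2 : ℝ) ^ (2 * a + 3) := by
  rw [show (2 : ℝ) ^ (3 * (a + (a + 2))) = ((2 : ℝ) ^ a * (2 : ℝ) ^ (2 * a + 3)) ^ 2 by ring,
    Real.sqrt_sq (by positivity)]

/-- **The Walsh/fibre identity for an almost-Maiorana–McFarland sign form** (stub `stub_ammWalsh`, tag AW,
of the line `direct-sum-amplification`; the `(a, a+2)`-block twin of `stub_mmWalsh`). If
`(-1)^{g(y₁ ‖ y₂)} = (-1)^{y₁·φ(y₂)} (-1)^{h(y₂)}` for `y₁ ∈ 𝔽₂^a`, `y₂ ∈ 𝔽₂^{a+2}` and an ARBITRARY map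
`φ : 𝔽₂^{a+2} → 𝔽₂^a` (no degree hypotheses), then for every `f`

  `Φ(f, g) = 2^{-(2a+3)} ∑_{y₂} (-1)^{h(y₂)} ∑_{x₂} (-1)^{f(φ(y₂) ‖ x₂)} (-1)^{x₂·y₂}`:

summing over the linear block `y₁` first gives
`W_{(-1)^g}(x₁ ‖ x₂) = 2^a ∑_{y₂ : φ(y₂) = x₁} (-1)^{h(y₂)} (-1)^{x₂·y₂}` (`aw_walsh_signForm`), the sum over
`x₁` collapses (`aw_fsum_signForm`), and `√(2^{3(a+(a+2))}) = 2^a · 2^{2a+3}` (`aw_sqrt_two_pow`).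
[folklore] -/
theorem stub_ammWalsh :
    ∀ (a : ℕ) (f g : (Fin (a + (a + 2)) → Bool) → Bool) (φ : (Fin (a + 2) → Bool) → (Fin a → Bool))
      (h : (Fin (a + 2) → Bool) → Bool),
      (∀ (y₁ : Fin a → Bool) (y₂ : Fin (a + 2) → Bool),
        signOf (g (Fin.append y₁ y₂)) = twist y₁ (φ y₂) * signOf (h y₂)) →
      forrelation f g = ((2 : ℝ) ^ (2 * a + 3))⁻¹ *
        ∑ y₂ : Fin (a + 2) → Bool, signOf (h y₂) *
          ∑ x₂ : Fin (a + 2) → Bool, signOf (f (Fin.append (φ y₂) x₂)) * twist x₂ y₂ := by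
  intro a f g φ h hg
  unfold forrelation
  rw [aw_fsum_signForm f g φ h hg, aw_sqrt_two_pow, mul_inv, mul_mul_mul_comm,
    inv_mul_cancel₀ (by positivity : (2 : ℝ) ^ a ≠ 0), one_mul]

end Summit.QuantumAdvantage.QuantumAdvantage.Theorems.CubicForrelation.NearExactIsExact
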